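import Literature.AlgebraicGeometry.AbelianSchemes.LevelBasisCoverFreeQuotient
import Literature.AlgebraicGeometry.AbelianSchemes.AbelianSchemeKOfLEtaleOfInvertibleOrder
import HarnessLib

/-!
# The level-`m`-basis cover as a free geometric quotient over a Noetherian affine base on which `m` is INVERTIBLE
# — ★ `LevelBasisCoverFreeQuotient` letters (Ma0)∕(Ma) with the `ℚ`-algebra hypothesis replaced by `IsUnit (m : R)` (letter (Ma′))

Layer `Literature/AlgebraicGeometry/AbelianSchemes`, namespace `Literature.AlgebraicGeometry.AbelianSchemes.AbelianSchemeOver`.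
THEOREMS ONLY (no definition, no named fact, no instance, no notation, no `sorry`; net Literature debt 0).

[MumfordFogartyKirwan1994] Ch. 7 §2 Prop. 7.3, proof, step (IV) (pp. 133–134) and §3 Lemma 7.11 (p. 140); [SGA1] Exp. V Prop. 2.6, Déf. 2.7:
for an abelian scheme `A → S` of relative dimension `g` and `m` INVERTIBLE ON `S`, the scheme of level-`m` bases is a finite étale
`GL_{2g}(ℤ∕m)`-torsor; ★ `LevelBasisCoverFreeQuotient` proves the universe-polymorphic heads under EXACTLY «`(m : κ(s)) ≠ 0` at every point»
(`exists_levelBasisCover_free_geometricQuotient`, `exists_connected_levelCover_free_geometricQuotient`) and specialises them to Noetherian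
affine `ℚ`-algebras (`…_of_algebra_rat`, letters (Ma0)∕(Ma) of the F-3 (M) child line).  THIS FILE is the characteristic-free
specialisation the (s2-D) road (A) re-thread reads at characteristic `p` (B-p04 (g39) census 2026-09-01T22:43:58Z, twin (Ma′)): the SAME two
letters over a Noetherian affine base `Spec R` with `hm : IsUnit ((m : ℕ) : R)` in place of `[Algebra ℚ R]` — `m` is then non-zero in every
residue field (★ (K′) `natCast_ne_zero_of_isUnit_specMap`, read at `fromSpecResidueField`), and the ★ heads apply verbatim.

* `natCast_residueField_spec_ne_zero_of_isUnit` — `IsUnit (m : R) ⇒ (m : κ(s)) ≠ 0` for every `s ∈ Spec R`;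
* **`exists_levelBasisCover_free_geometricQuotient_of_isUnit`** = ★ `…_of_algebra_rat` with `[Algebra ℚ R]` ↦ `(hm : IsUnit ((m : ℕ) : R))`;
* **`exists_connected_levelCover_free_geometricQuotient_of_isUnit`** = ★ `exists_connected_levelCover_…_of_algebra_rat` likewise.

Cell `hodgecm-mathlib` (D-0151), P6 «MOD programme», PAY-DOWN CAPITAL of the printed row P-2′ «DUAL-S» (LEAD F0P6-plan «M-29» (2); B-p04 (g40)
offer (O3), road (A) Literature twins (Mb′) ★ p847247, (Ma′) this file, (Sb′), (Se′)).  Count-neutral; HC_CM is proved only modulo the printed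
citations (2 remaining named inputs hLiu418 24832, h413 24833) until rung 0 closes; nothing here is about HC.

## References
* [MumfordFogartyKirwan1994] D. Mumford, J. Fogarty, F. Kirwan, *Geometric Invariant Theory*, 3rd ed. (1994), Ch. 7 §2 Proposition 7.3, proof,
  step (IV) (pp. 133–134); Ch. 7 §3 Lemma 7.11 (p. 140).
* [SGA1] A. Grothendieck, *SGA 1*, Exp. V Prop. 2.6, Déf. 2.7 (quotients by finite groups acting freely; Galois covers).
* [GortzWedhorn2023] U. Görtz, T. Wedhorn, *Algebraic Geometry II* (2023), Prop. 27.188 (1) (p. 675) (`A[m]` finite étale when `m` is invertible).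
* Tree: ★ `LevelBasisCoverFreeQuotient` (`exists_levelBasisCover_free_geometricQuotient`, `exists_connected_levelCover_free_geometricQuotient`),
  ★ `AbelianSchemeKOfLEtaleOfInvertibleOrder` (`natCast_ne_zero_of_isUnit_specMap`), ★ `AbelianSchemeOverHomNoetherianAnyBase`∕`CommOfReduced`
  lineage (`isCommMonObj_of_isLocallyNoetherian_base`).
-/

set_option autoImplicit false

noncomputable section

open CategoryTheory CategoryTheory.Limits AlgebraicGeometry

namespace Literature.AlgebraicGeometry.AbelianSchemes

open Literature.AlgebraicGeometry.RelativeSpec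

namespace AbelianSchemeOver

/-- `m` invertible in `R` ⇒ `m ≠ 0` in every residue field of `Spec R` (a unit maps to a unit under `R → κ(s)`).
[cite: GortzWedhorn2023, Prop. 27.188 (1) (p. 675)] -/
theorem natCast_residueField_spec_ne_zero_of_isUnit (R : Type) [CommRing R] {m : ℕ} (hm : IsUnit ((m : ℕ) : R))
    (s : ↥(Spec (.of R))) : (m : (Spec (.of R)).residueField s) ≠ 0 :=
  natCast_ne_zero_of_isUnit_specMap ((Spec (.of R)).fromSpecResidueField s) hm

/-- **Letter (Ma0) over a Noetherian affine base on which `m` is invertible** ([MumfordFogartyKirwan1994] Prop. 7.3 step (IV) ∕ Lemma 7.11):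
the level-`m`-basis cover is a finite étale surjective `p : S′ → Spec R` with `S′` affine, carrying a `GL_{2g}(ℤ∕m)`-action of which `Spec R` is
the geometric quotient and which is free on the affine charts, and `A ×_R S′` has a level-`m` structure — ★
`exists_levelBasisCover_free_geometricQuotient_of_algebra_rat` with `[Algebra ℚ R]` replaced by `IsUnit (m : R)`.
[cite: MumfordFogartyKirwan1994, Ch. 7 §2 Proposition 7.3, proof, step (IV) (pp. 133–134)] [cite: MumfordFogartyKirwan1994, Ch. 7 §3 Lemma 7.11 (p. 140)]
[cite: SGA1, Exp. V Prop. 2.6, Déf. 2.7] -/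
theorem exists_levelBasisCover_free_geometricQuotient_of_isUnit (R : Type) [CommRing R] [IsNoetherianRing R]
    (A : AbelianSchemeOver (Spec (.of R))) {g : ℕ} (hg : A.IsOfRelDim g) (m : ℕ) [NeZero m] (hm : IsUnit ((m : ℕ) : R)) :
    ∃ (S' : Scheme.{0}) (p : S' ⟶ Spec (.of R)) (_ : IsAffine S') (_ : IsAffineHom p) (_ : IsFinite p) (_ : Etale p)
      (_ : Surjective p) (ρ : ActionOver p (Matrix.GeneralLinearGroup (Fin g ⊕ Fin g) (ZMod m))),
      ρ.IsGeometricQuotient p ∧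
      (∀ (V : (Spec (.of R)).Opens), IsAffineOpen V → ∀ γ₀ : Matrix.GeneralLinearGroup (Fin g ⊕ Fin g) (ZMod m), γ₀ ≠ 1 →
        Ideal.span (Set.range fun s : Γ(S', p ⁻¹ᵁ V) ↦ ρ.act γ₀ V s - s) = ⊤) ∧
      Nonempty (AbelianSchemeOver.LevelStructure g m (A.baseChange p)) := by
  haveI : IsCommMonObj A.X := A.isCommMonObj_of_isLocallyNoetherian_base
  obtain ⟨B, b, hfin, het, hsurj, ρ, hq, hfree, hlev⟩ :=
    A.exists_levelBasisCover_free_geometricQuotient hg (natCast_residueField_spec_ne_zero_of_isUnit R hm)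
  haveI := hfin
  haveI : IsAffine B := isAffine_of_isAffineHom b
  exact ⟨B, b, inferInstance, inferInstance, hfin, het, hsurj, ρ, hq, hfree, hlev⟩

/-- **Letter (Ma) over a CONNECTED Noetherian affine base on which `m` is invertible**: a CONNECTED affine finite étale surjective cover
`p : S′ → Spec R`, a finite group `G` acting freely with `Spec R` the geometric quotient, and a level-`m` structure on `A ×_R S′` — ★
`exists_connected_levelCover_free_geometricQuotient_of_algebra_rat` with `[Algebra ℚ R]` replaced by `IsUnit (m : R)`.
[cite: MumfordFogartyKirwan1994, Ch. 7 §3 Lemma 7.11 (p. 140)] [cite: SGA1, Exp. V Prop. 2.6, Déf. 2.7] -/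
theorem exists_connected_levelCover_free_geometricQuotient_of_isUnit (R : Type) [CommRing R] [IsNoetherianRing R]
    [ConnectedSpace ↥(Spec (.of R))] (A : AbelianSchemeOver (Spec (.of R))) {g : ℕ} (hg : A.IsOfRelDim g) (m : ℕ) [NeZero m]
    (hm : IsUnit ((m : ℕ) : R)) :
    ∃ (S' : Scheme.{0}) (p : S' ⟶ Spec (.of R)) (_ : IsAffine S') (_ : ConnectedSpace S') (_ : IsAffineHom p) (_ : IsFinite p)
      (_ : Etale p) (_ : Surjective p) (G : Type) (_ : Group G) (_ : Fintype G) (ρ : ActionOver p G),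
      ρ.IsGeometricQuotient p ∧
      (∀ (V : (Spec (.of R)).Opens), IsAffineOpen V → ∀ γ₀ : G, γ₀ ≠ 1 →
        Ideal.span (Set.range fun s : Γ(S', p ⁻¹ᵁ V) ↦ ρ.act γ₀ V s - s) = ⊤) ∧
      Nonempty (AbelianSchemeOver.LevelStructure g m (A.baseChange p)) := by
  haveI : IsCommMonObj A.X := A.isCommMonObj_of_isLocallyNoetherian_base
  obtain ⟨C, c, hconn, hfin, het, hsurj, H, iH, fH, ρ, hq, hfree, hlev⟩ :=
    A.exists_connected_levelCover_free_geometricQuotient hg (natCast_residueField_spec_ne_zero_of_isUnit R hm)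
  haveI := hfin
  haveI : IsAffine C := isAffine_of_isAffineHom c
  exact ⟨C, c, inferInstance, hconn, inferInstance, hfin, het, hsurj, H, iH, fH, ρ, hq, hfree, hlev⟩

end AbelianSchemeOver

end Literature.AlgebraicGeometry.AbelianSchemes

end
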